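import Mathlib.MeasureTheory.Function.JacobianOneDim
import Mathlib.Analysis.SpecialFunctions.ExpDeriv
import Mathlib.Analysis.SpecialFunctions.Log.Basic
import Mathlib.Analysis.SpecialFunctions.Sqrt
import Literature.Analysis.FluidPDE.SpaceTimeRescaling
import Literature.Analysis.FluidPDE.SpaceTimeCalculus
import HarnessLib

/-!
# The similarity variables `y = x/√(2t)`, `s = log √(2t)` of forward self-similar Navier–Stokes:
  change of variables and chain rules

Analysis/FluidPDE support file (serves the discharge of
`Literature.Analysis.FluidPDE.bradshawTsai2017_ansatz_transport`, Bradshaw–Tsai 2017 [BT1] §4: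
the passage from suitable periodic weak solutions of the time-dependent Leray system in the
similarity variables to solutions of Navier–Stokes in the physical variables). The companion of
the accepted affine toolkit `SpaceTimeRescaling` for the **non-affine** diffeomorphism

  `Φ(s, y) = (t, x) = (e^{2s}/2, eˢ y) : ℝ × E → (0,∞) × E`,  `Φ⁻¹(t, x) = (log √(2t), x/√(2t))`

([BT1] (1.7): "`y = x/√(2t)`, `s = log(√(2t))`"), whose Jacobian is `e^{(n+2)s}`
(`dt = e^{2s} ds`, `dx = e^{ns} dy`, `n = dim E`).

## Contents

* `simTime s = e^{2s}/2`, `simTimeInv t = log √(2t)`, `simMap`, `simInv`, `simDensity`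
  (`= e^{(n+2)s}` as an `ℝ≥0`-valued density); inversion formulas, smoothness, measurability,
  `MeasurableEmbedding simMap`, compactness of `Φ⁻¹(K)` for compact `K` in the open slab.
* **The push-forward of Lebesgue measure**: `map_simMap_withDensity`,
  `Φ_*(e^{(n+2)s} ds dy) = dt dx|_{(0,∞) × E}` (from Tonelli, the linear change of variables
  `x = eˢ y` in the fibres and the one-dimensional change of variables `t = e^{2s}/2`), with the
  resulting formulas for `∫⁻`, `∫` over the slab and over subsets, for integrability on subsets,
  and for local integrability on the slab of fields `c(z) • H(Φ⁻¹ z)`; the one-variable formulas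
  `∫_{t>0} g = ∫ e^{2s} g(τ s) ds`, `∫ f(eˢ y) dy = e^{-ns} ∫ f`.
* `simPull ψ = ψ ∘ Φ` for time-first fields and the **chain rules**: `D_y`, `∇_y`, `div_y`,
  `(a·∇_y)`, `Δ_y` of `ψ ∘ Φ` (`= eˢ D_xψ ∘ Φ`, …, `e^{2s} Δ_xψ ∘ Φ`) and the time derivative
  `∂ₛ(ψ ∘ Φ) = e^{2s} ∂ₜψ ∘ Φ + D_xψ(Φ)[eˢ y]` for jointly differentiable `ψ` ([BT1] §4:
  "`∂ₜζ = (2t)⁻²(∂ₛ − 2 − y·∇_y)f`"); pull-back of space–time test fields on the slab to test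
  fields on all of `ℝ × E`, also with smooth time weights `w(s)`.

## References

* Z. Bradshaw, T.-P. Tsai, Ann. Henri Poincaré 18 (2017) = arXiv:1510.07504, (1.6)–(1.7) and §4
  (proof of Thm 1.2) [BradshawTsai2017AHP].
* L. C. Evans, *Partial differential equations*, App. C (change of variables) [Evans2010].
-/

noncomputable section

open MeasureTheory TopologicalSpace Set Function Filter Topology Module Metric
open scoped InnerProductSpace RealInnerProductSpace ENNReal NNReal Laplacian

namespace Literature.Analysis.FluidPDE

/-! ### The time maps `τ(s) = e^{2s}/2` and `σ(t) = log √(2t)` -/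

/-- The physical time of the similarity time `s`: `τ(s) = e^{2s}/2`, inverse of `s = log √(2t)`
([BT1] (1.7)). [cite: BradshawTsai2017AHP, (1.7)] -/
def simTime (s : ℝ) : ℝ := Real.exp (2 * s) / 2

/-- The similarity time of the physical time `t > 0`: `σ(t) = log √(2t)` ([BT1] (1.7)); junk for
`t ≤ 0`. [cite: BradshawTsai2017AHP, (1.7)] -/
def simTimeInv (t : ℝ) : ℝ := Real.log (Real.sqrt (2 * t))

/-- `τ(s) > 0`. [folklore] -/
theorem simTime_pos (s : ℝ) : 0 < simTime s := by unfold simTime; positivity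

/-- `2 τ(s) = e^{2s}`. [folklore] -/
theorem two_mul_simTime (s : ℝ) : 2 * simTime s = Real.exp (2 * s) := by unfold simTime; ring

/-- `√(2 τ(s)) = eˢ`. [folklore] -/
theorem sqrt_two_mul_simTime (s : ℝ) : Real.sqrt (2 * simTime s) = Real.exp s := by
  rw [two_mul_simTime, two_mul, Real.exp_add, ← sq, Real.sqrt_sq (Real.exp_pos s).le]

/-- `σ(τ(s)) = s`. [folklore] -/
@[simp]
theorem simTimeInv_simTime (s : ℝ) : simTimeInv (simTime s) = s := by
  rw [simTimeInv, sqrt_two_mul_simTime, Real.log_exp]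

/-- `e^{σ(t)} = √(2t)` for `t > 0`. [folklore] -/
theorem exp_simTimeInv {t : ℝ} (ht : 0 < t) : Real.exp (simTimeInv t) = Real.sqrt (2 * t) :=
  Real.exp_log (Real.sqrt_pos.2 (by linarith))

/-- `τ(σ(t)) = t` for `t > 0`. [folklore] -/
theorem simTime_simTimeInv {t : ℝ} (ht : 0 < t) : simTime (simTimeInv t) = t := by
  rw [simTime, two_mul, Real.exp_add, exp_simTimeInv ht, Real.mul_self_sqrt (by linarith)]
  ring

/-- `τ'(s) = e^{2s}`. [folklore] -/
theorem hasDerivAt_simTime (s : ℝ) : HasDerivAt simTime (Real.exp (2 * s)) s := by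
  have h := (((hasDerivAt_id s).const_mul (2 : ℝ)).exp).div_const 2
  simp only [id_eq, mul_one] at h
  rwa [show Real.exp (2 * s) * 2 / 2 = Real.exp (2 * s) by ring] at h

/-- `τ` is smooth. [folklore] -/
theorem contDiff_simTime {n : WithTop ℕ∞} : ContDiff ℝ n simTime :=
  (Real.contDiff_exp.comp (contDiff_const.mul contDiff_id)).div_const 2

/-- `τ` is continuous. [folklore] -/
theorem continuous_simTime : Continuous simTime := contDiff_simTime (n := 0).continuous

/-- `τ` is injective. [folklore] -/
theorem simTime_injective : Injective simTime :=
  HasLeftInverse.injective ⟨simTimeInv, simTimeInv_simTime⟩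

/-- The range of `τ` is `(0, ∞)`. [folklore] -/
theorem range_simTime : range simTime = Ioi 0 :=
  Set.ext fun t => ⟨fun ⟨s, hs⟩ => hs ▸ simTime_pos s, fun ht => ⟨simTimeInv t, simTime_simTimeInv ht⟩⟩

/-- `σ` is measurable. [folklore] -/
theorem measurable_simTimeInv : Measurable simTimeInv :=
  Real.measurable_log.comp (Real.continuous_sqrt.measurable.comp (measurable_const_mul 2))

/-- `σ` is continuous on `(0, ∞)`. [folklore] -/
theorem continuousOn_simTimeInv : ContinuousOn simTimeInv (Ioi 0) := by
  refine ContinuousOn.log (by fun_prop) fun t ht => ?_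
  exact (Real.sqrt_pos.2 (by simpa using mul_pos two_pos (mem_Ioi.1 ht))).ne'

/-! ### The space–time map `Φ(s, y) = (e^{2s}/2, eˢ y)` -/

section Map

variable {E : Type*} [NormedAddCommGroup E] [NormedSpace ℝ E]

/-- **The similarity change of variables** `Φ(s, y) = (t, x) = (e^{2s}/2, eˢ y)` (time first), the
inverse of [BT1] (1.7) `y = x/√(2t)`, `s = log √(2t)`. [cite: BradshawTsai2017AHP, (1.7)] -/
def simMap (z : ℝ × E) : ℝ × E := (simTime z.1, Real.exp z.1 • z.2)

/-- The map `(t, x) ↦ (s, y) = (log √(2t), x/√(2t))` of [BT1] (1.7), inverse to `simMap` on the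
slab `t > 0` (junk for `t ≤ 0`). [cite: BradshawTsai2017AHP, (1.7)] -/
def simInv (z : ℝ × E) : ℝ × E := (simTimeInv z.1, (Real.sqrt (2 * z.1))⁻¹ • z.2)

/-- Components of `Φ`. [folklore] -/
@[simp]
theorem simMap_apply (s : ℝ) (y : E) : simMap (s, y) = (simTime s, Real.exp s • y) := rfl

/-- Components of `Φ⁻¹`. [folklore] -/
@[simp]
theorem simInv_apply (t : ℝ) (x : E) : simInv (t, x) = (simTimeInv t, (Real.sqrt (2 * t))⁻¹ • x) :=
  rfl

/-- `Φ⁻¹ ∘ Φ = id`. [folklore] -/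
@[simp]
theorem simInv_simMap (z : ℝ × E) : simInv (simMap z) = z := by
  obtain ⟨s, y⟩ := z
  simp only [simMap_apply, simInv_apply, simTimeInv_simTime, sqrt_two_mul_simTime, smul_smul,
    inv_mul_cancel₀ (Real.exp_pos s).ne', one_smul]

/-- `Φ ∘ Φ⁻¹ = id` on the slab `t > 0`. [folklore] -/
theorem simMap_simInv {z : ℝ × E} (hz : 0 < z.1) : simMap (simInv z) = z := by
  obtain ⟨t, x⟩ := z
  have hsq : 0 < Real.sqrt (2 * t) := Real.sqrt_pos.2 (by simpa using mul_pos two_pos hz)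
  simp only [simInv_apply, simMap_apply, simTime_simTimeInv hz, exp_simTimeInv hz, smul_smul,
    mul_inv_cancel₀ hsq.ne', one_smul]

/-- `Φ` is injective. [folklore] -/
theorem simMap_injective : Injective (simMap : ℝ × E → ℝ × E) :=
  HasLeftInverse.injective ⟨simInv, simInv_simMap⟩

/-- `Φ(s, y)` lies in the open slab `t > 0`. [folklore] -/
theorem simMap_mem_slab (z : ℝ × E) : simMap z ∈ Ioi (0 : ℝ) ×ˢ (univ : Set E) :=
  ⟨simTime_pos _, mem_univ _⟩

/-- The range of `Φ` is the open slab `(0, ∞) × E`. [folklore] -/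
theorem range_simMap : range (simMap : ℝ × E → ℝ × E) = Ioi (0 : ℝ) ×ˢ (univ : Set E) :=
  Set.ext fun z => ⟨fun ⟨w, hw⟩ => hw ▸ simMap_mem_slab w, fun hz => ⟨simInv z, simMap_simInv hz.1⟩⟩

/-- `Φ⁻¹(slab) = everything`. [folklore] -/
@[simp]
theorem preimage_simMap_slab :
    (simMap : ℝ × E → ℝ × E) ⁻¹' (Ioi (0 : ℝ) ×ˢ (univ : Set E)) = univ :=
  eq_univ_of_forall fun z => simMap_mem_slab z

/-- For `A` in the slab, `Φ⁻¹(A) = Φ⁻¹ '' A`… concretely `Φ⁻¹(A)` is the image of `A` under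
`simInv`. [folklore] -/
theorem preimage_simMap_eq_image_simInv {A : Set (ℝ × E)} (hA : A ⊆ Ioi (0 : ℝ) ×ˢ (univ : Set E)) :
    (simMap : ℝ × E → ℝ × E) ⁻¹' A = simInv '' A := by
  ext z
  refine ⟨fun hz => ⟨simMap z, hz, simInv_simMap z⟩, ?_⟩
  rintro ⟨w, hw, rfl⟩
  show simMap (simInv w) ∈ A
  rwa [simMap_simInv (hA hw).1]

/-- `Φ` is smooth. [folklore] -/
theorem contDiff_simMap {n : WithTop ℕ∞} : ContDiff ℝ n (simMap : ℝ × E → ℝ × E) :=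
  (contDiff_simTime.comp contDiff_fst).prodMk
    ((Real.contDiff_exp.comp contDiff_fst).smul contDiff_snd)

/-- `Φ` is continuous. [folklore] -/
theorem continuous_simMap : Continuous (simMap : ℝ × E → ℝ × E) :=
  (contDiff_simMap (n := 0)).continuous

/-- `Φ⁻¹` is continuous on the slab `t > 0`. [folklore] -/
theorem continuousOn_simInv : ContinuousOn (simInv : ℝ × E → ℝ × E) (Ioi (0 : ℝ) ×ˢ univ) := by
  refine ContinuousOn.prodMk (continuousOn_simTimeInv.comp continuous_fst.continuousOn
    fun z hz => hz.1) (ContinuousOn.smul ?_ continuous_snd.continuousOn)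
  refine ContinuousOn.inv₀ (by fun_prop) fun z hz => ?_
  exact (Real.sqrt_pos.2 (by simpa using mul_pos two_pos (mem_Ioi.1 (mem_prod.1 hz).1))).ne'

/-- `Φ⁻¹(K)` is compact for every compact `K` inside the open slab (it is `Φ⁻¹ '' K` with `Φ⁻¹`
continuous on the slab). [folklore] -/
theorem isCompact_preimage_simMap {K : Set (ℝ × E)} (hK : IsCompact K)
    (hKs : K ⊆ Ioi (0 : ℝ) ×ˢ (univ : Set E)) : IsCompact ((simMap : ℝ × E → ℝ × E) ⁻¹' K) := by
  rw [preimage_simMap_eq_image_simInv hKs]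
  exact hK.image_of_continuousOn (continuousOn_simInv.mono hKs)

variable [MeasurableSpace E] [BorelSpace E] [SecondCountableTopology E]

/-- `Φ` is measurable. [folklore] -/
theorem measurable_simMap : Measurable (simMap : ℝ × E → ℝ × E) := continuous_simMap.measurable

/-- `Φ⁻¹` is measurable. [folklore] -/
theorem measurable_simInv : Measurable (simInv : ℝ × E → ℝ × E) :=
  (measurable_simTimeInv.comp measurable_fst).prodMk
    (((Real.continuous_sqrt.measurable.comp (measurable_const_mul 2)).comp measurable_fst).inv.smul
      measurable_snd)

/-- **`Φ` is a measurable embedding** (measurable, with measurable range and a measurable left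
inverse). [folklore] -/
theorem measurableEmbedding_simMap : MeasurableEmbedding (simMap : ℝ × E → ℝ × E) :=
  MeasurableEmbedding.of_measurable_inverse measurable_simMap
    (by rw [range_simMap]; exact measurableSet_Ioi.prod MeasurableSet.univ)
    measurable_simInv simInv_simMap

end Map

/-! ### The Jacobian `e^{(n+2)s}` and the push-forward of Lebesgue measure -/

section Measure

variable {E : Type*} [NormedAddCommGroup E] [InnerProductSpace ℝ E] [FiniteDimensional ℝ E]
  [MeasurableSpace E] [BorelSpace E]

variable (E) in
/-- The Jacobian of `Φ` as an `ℝ≥0`-valued density: `simDensity E z = e^{(n+2)s}`, `n = dim E`,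
`z = (s, y)` (`dt dx = e^{2s} · e^{ns} ds dy`). [folklore] -/
def simDensity (z : ℝ × E) : ℝ≥0 :=
  ⟨Real.exp ((finrank ℝ E + 2 : ℝ) * z.1), (Real.exp_pos _).le⟩

omit [FiniteDimensional ℝ E] [MeasurableSpace E] [BorelSpace E] in
/-- The density as a real number. [folklore] -/
@[simp]
theorem coe_simDensity (z : ℝ × E) :
    (simDensity E z : ℝ) = Real.exp ((finrank ℝ E + 2 : ℝ) * z.1) := rfl

omit [FiniteDimensional ℝ E] [MeasurableSpace E] [BorelSpace E] in
/-- The density is positive. [folklore] -/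
theorem simDensity_pos (z : ℝ × E) : 0 < (simDensity E z : ℝ) := Real.exp_pos _

omit [FiniteDimensional ℝ E] [MeasurableSpace E] [BorelSpace E] in
/-- The density is continuous. [folklore] -/
theorem continuous_simDensity : Continuous (simDensity E) :=
  continuous_induced_rng.2 ((Real.continuous_exp.comp (continuous_const.mul continuous_fst)))

/-- The density is measurable. [folklore] -/
theorem measurable_simDensity : Measurable (simDensity E) := continuous_simDensity.measurable

omit [FiniteDimensional ℝ E] [MeasurableSpace E] [BorelSpace E] in
/-- `e^{(n+2)s} = e^{2s} e^{ns}` in the form used below: `e^{(n+2)s} (eˢ)^{-n} = e^{2s}`. [folklore] -/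
theorem simDensity_mul_inv_pow (s : ℝ) (y : E) :
    (simDensity E (s, y) : ℝ) * (Real.exp s ^ finrank ℝ E)⁻¹ = Real.exp (2 * s) := by
  rw [coe_simDensity, ← Real.exp_nat_mul, ← Real.exp_neg, ← Real.exp_add]
  congr 1
  simp only
  ring

/-- **One-dimensional change of variables `t = e^{2s}/2`** (lower integral):
`∫⁻_{t>0} g(t) dt = ∫⁻ e^{2s} g(τ(s)) ds`. [folklore] -/
theorem lintegral_Ioi_eq_lintegral_simTime (g : ℝ → ℝ≥0∞) :
    ∫⁻ t in Ioi 0, g t = ∫⁻ s, ENNReal.ofReal (Real.exp (2 * s)) * g (simTime s) := by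
  have h := lintegral_image_eq_lintegral_abs_deriv_mul MeasurableSet.univ
    (fun s _ => (hasDerivAt_simTime s).hasDerivWithinAt) simTime_injective.injOn g
  rw [image_univ, range_simTime, Measure.restrict_univ] at h
  rw [h]
  refine lintegral_congr fun s => ?_
  rw [abs_of_pos (Real.exp_pos _)]

/-- **One-dimensional change of variables `t = e^{2s}/2`** (Bochner):
`∫_{t>0} g(t) dt = ∫ e^{2s} g(τ(s)) ds`. [folklore] -/
theorem integral_Ioi_eq_integral_simTime {G : Type*} [NormedAddCommGroup G] [NormedSpace ℝ G]
    (g : ℝ → G) : ∫ t in Ioi 0, g t = ∫ s, Real.exp (2 * s) • g (simTime s) := by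
  have h := integral_image_eq_integral_abs_deriv_smul MeasurableSet.univ
    (fun s _ => (hasDerivAt_simTime s).hasDerivWithinAt) simTime_injective.injOn g
  rw [image_univ, range_simTime, Measure.restrict_univ] at h
  rw [h]
  refine integral_congr_ae (Eventually.of_forall fun s => ?_)
  simp only [abs_of_pos (Real.exp_pos _)]

/-- **Linear change of variables `x = eˢ y` in the fibres** (lower integral):
`∫⁻ f(eˢ y) dy = e^{-ns} ∫⁻ f`. [folklore] -/
theorem lintegral_comp_exp_smul (s : ℝ) (f : E → ℝ≥0∞) :
    ∫⁻ y, f (Real.exp s • y) = ENNReal.ofReal (Real.exp s ^ finrank ℝ E)⁻¹ * ∫⁻ x, f x := by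
  have h := lintegral_comp_space_affine (Real.exp_pos s) (0 : E) f
  simpa only [zero_add] using h

/-- **Linear change of variables `x = eˢ y` in the fibres** (Bochner): `∫ f(eˢ y) dy = e^{-ns} ∫ f`. [folklore] -/
theorem integral_comp_exp_smul {G : Type*} [NormedAddCommGroup G] [NormedSpace ℝ G] (s : ℝ)
    (f : E → G) : ∫ y, f (Real.exp s • y) = (Real.exp s ^ finrank ℝ E)⁻¹ • ∫ x, f x := by
  have h := integral_comp_space_affine (Real.exp_pos s) (0 : E) f
  simpa only [zero_add] using h

/-- The key Tonelli computation: `∫⁻ e^{(n+2)s} F(Φ(s,y)) ds dy = ∫⁻_{(0,∞)×E} F` for measurable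
`F ≥ 0`. [folklore] -/
theorem lintegral_simDensity_mul_comp_simMap {F : ℝ × E → ℝ≥0∞} (hF : Measurable F) :
    ∫⁻ z, (simDensity E z : ℝ≥0∞) * F (simMap z) = ∫⁻ z in Ioi (0 : ℝ) ×ˢ (univ : Set E), F z := by
  have hmeas : Measurable fun z : ℝ × E => (simDensity E z : ℝ≥0∞) * F (simMap z) :=
    measurable_simDensity.coe_nnreal_ennreal.mul (hF.comp measurable_simMap)
  -- both sides as iterated integrals
  have hL : ∫⁻ z, (simDensity E z : ℝ≥0∞) * F (simMap z) =
      ∫⁻ s : ℝ, ∫⁻ y : E, (simDensity E (s, y) : ℝ≥0∞) * F (simMap (s, y)) := by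
    rw [Measure.volume_eq_prod, lintegral_prod _ hmeas.aemeasurable]
  have hR : ∫⁻ z in Ioi (0 : ℝ) ×ˢ (univ : Set E), F z = ∫⁻ t in Ioi 0, ∫⁻ x : E, F (t, x) := by
    rw [Measure.volume_eq_prod, ← Measure.prod_restrict, Measure.restrict_univ,
      lintegral_prod _ hF.aemeasurable]
  -- inner integrals: the linear change of variables `x = eˢ y`
  have hinner : ∀ s : ℝ, ∫⁻ y, (simDensity E (s, y) : ℝ≥0∞) * F (simMap (s, y)) =
      ENNReal.ofReal (Real.exp (2 * s)) * ∫⁻ x, F (simTime s, x) := by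
    intro s
    have h1 : ∀ y : E, (simDensity E (s, y) : ℝ≥0∞) * F (simMap (s, y)) =
        ENNReal.ofReal (Real.exp ((finrank ℝ E + 2 : ℝ) * s)) *
          (fun x => F (simTime s, x)) (Real.exp s • y) := by
      intro y
      rw [← ENNReal.ofReal_coe_nnreal, coe_simDensity, simMap_apply]
    simp_rw [h1]
    have hm : Measurable fun y : E => F (simTime s, Real.exp s • y) :=
      hF.comp (measurable_const.prodMk (measurable_const_smul _))
    rw [lintegral_const_mul _ hm, lintegral_comp_exp_smul s fun x => F (simTime s, x), ← mul_assoc,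
      ← ENNReal.ofReal_mul (Real.exp_pos _).le]
    congr 2
    have := simDensity_mul_inv_pow (E := E) s 0
    rwa [coe_simDensity] at this
  rw [hL, hR]
  simp_rw [hinner]
  -- outer integral: the one-dimensional change of variables `t = e^{2s}/2`
  rw [lintegral_Ioi_eq_lintegral_simTime]

/-- **The push-forward of Lebesgue measure under the similarity change of variables**:
`Φ_*(e^{(n+2)s} ds dy) = dt dx` restricted to the open slab `(0,∞) × E`. [folklore] -/
theorem map_simMap_withDensity :
    Measure.map (simMap : ℝ × E → ℝ × E) (volume.withDensity fun z => (simDensity E z : ℝ≥0∞)) =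
      (volume : Measure (ℝ × E)).restrict (Ioi (0 : ℝ) ×ˢ univ) := by
  ext A hA
  rw [Measure.map_apply measurable_simMap hA, withDensity_apply _ (measurable_simMap hA),
    Measure.restrict_apply hA]
  have key := lintegral_simDensity_mul_comp_simMap (E := E) (F := A.indicator 1)
    (measurable_one.indicator hA)
  have h1 : (fun z : ℝ × E => (simDensity E z : ℝ≥0∞) * A.indicator 1 (simMap z)) =
      ((simMap : ℝ × E → ℝ × E) ⁻¹' A).indicator fun z => (simDensity E z : ℝ≥0∞) := by
    funext z
    by_cases hz : simMap z ∈ A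
    · rw [indicator_of_mem hz, indicator_of_mem (show z ∈ simMap ⁻¹' A from hz), Pi.one_apply,
        mul_one]
    · rw [indicator_of_notMem hz, indicator_of_notMem (show z ∉ simMap ⁻¹' A from hz), mul_zero]
  rw [h1, lintegral_indicator (measurable_simMap hA), lintegral_indicator hA] at key
  simp_rw [Pi.one_apply] at key
  rw [setLIntegral_one, Measure.restrict_apply hA] at key
  exact key

/-- **Change of variables over the slab** (lower integral, no measurability needed):
`∫⁻_{(0,∞)×E} F = ∫⁻ e^{(n+2)s} F(Φ z) dz`. [folklore] -/
theorem lintegral_slab_eq_lintegral_simMap (F : ℝ × E → ℝ≥0∞) :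
    ∫⁻ z in Ioi (0 : ℝ) ×ˢ (univ : Set E), F z = ∫⁻ z, (simDensity E z : ℝ≥0∞) * F (simMap z) := by
  rw [← map_simMap_withDensity, measurableEmbedding_simMap.lintegral_map,
    lintegral_withDensity_eq_lintegral_mul_non_measurable _
      measurable_simDensity.coe_nnreal_ennreal (Eventually.of_forall fun _ => ENNReal.coe_lt_top)]
  rfl

/-- **Change of variables over a subset of the slab** (lower integral):
`∫⁻_{A ∩ slab} F = ∫⁻_{Φ⁻¹ A} e^{(n+2)s} F(Φ z) dz`. [folklore] -/
theorem setLIntegral_inter_slab_eq_simMap (F : ℝ × E → ℝ≥0∞) {A : Set (ℝ × E)}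
    (hA : MeasurableSet A) :
    ∫⁻ z in A ∩ Ioi (0 : ℝ) ×ˢ (univ : Set E), F z =
      ∫⁻ z in simMap ⁻¹' A, (simDensity E z : ℝ≥0∞) * F (simMap z) := by
  rw [← Measure.restrict_restrict hA, ← map_simMap_withDensity,
    measurableEmbedding_simMap.restrict_map, measurableEmbedding_simMap.lintegral_map,
    restrict_withDensity (measurable_simMap hA),
    lintegral_withDensity_eq_lintegral_mul_non_measurable _
      measurable_simDensity.coe_nnreal_ennreal (Eventually.of_forall fun _ => ENNReal.coe_lt_top)]
  rfl

/-- **Change of variables over the slab** (Bochner, no measurability or integrability needed):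
`∫_{(0,∞)×E} F = ∫ e^{(n+2)s} F(Φ z) dz`. [folklore] -/
theorem integral_slab_eq_integral_simMap {G : Type*} [NormedAddCommGroup G] [NormedSpace ℝ G]
    (F : ℝ × E → G) :
    ∫ z in Ioi (0 : ℝ) ×ˢ (univ : Set E), F z = ∫ z, (simDensity E z : ℝ) • F (simMap z) := by
  rw [← map_simMap_withDensity, measurableEmbedding_simMap.integral_map,
    integral_withDensity_eq_integral_smul measurable_simDensity]
  rfl

/-- **Change of variables over a subset of the slab** (Bochner):
`∫_{A ∩ slab} F = ∫_{Φ⁻¹ A} e^{(n+2)s} F(Φ z) dz`. [folklore] -/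
theorem setIntegral_inter_slab_eq_simMap {G : Type*} [NormedAddCommGroup G] [NormedSpace ℝ G]
    (F : ℝ × E → G) {A : Set (ℝ × E)} (hA : MeasurableSet A) :
    ∫ z in A ∩ Ioi (0 : ℝ) ×ˢ (univ : Set E), F z =
      ∫ z in simMap ⁻¹' A, (simDensity E z : ℝ) • F (simMap z) := by
  rw [← Measure.restrict_restrict hA, ← map_simMap_withDensity,
    measurableEmbedding_simMap.restrict_map, measurableEmbedding_simMap.integral_map,
    restrict_withDensity (measurable_simMap hA),
    integral_withDensity_eq_integral_smul measurable_simDensity]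
  rfl

/-- **Integrability on subsets of the slab**: `F` is integrable on `A ∩ slab` iff
`e^{(n+2)s} F ∘ Φ` is integrable on `Φ⁻¹(A)`. [folklore] -/
theorem integrableOn_inter_slab_iff {G : Type*} [NormedAddCommGroup G] [NormedSpace ℝ G]
    (F : ℝ × E → G) {A : Set (ℝ × E)} (hA : MeasurableSet A) :
    IntegrableOn F (A ∩ Ioi (0 : ℝ) ×ˢ (univ : Set E)) volume ↔
      IntegrableOn (fun z => (simDensity E z : ℝ) • F (simMap z)) (simMap ⁻¹' A) volume := by
  rw [IntegrableOn, IntegrableOn, ← Measure.restrict_restrict hA, ← map_simMap_withDensity,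
    measurableEmbedding_simMap.restrict_map, measurableEmbedding_simMap.integrable_map_iff,
    restrict_withDensity (measurable_simMap hA),
    integrable_withDensity_iff_integrable_smul measurable_simDensity]
  rfl

/-- **Iterated change of variables** (Bochner): for a field vanishing at times `t ≤ 0`,
`∫ dt ∫ dx F(t, x) = ∫ ds ∫ dy e^{(n+2)s} F(Φ(s, y))` (time and space substitutions separately; no
integrability needed). [folklore] -/
theorem integral_integral_eq_simMap {G : Type*} [NormedAddCommGroup G] [NormedSpace ℝ G]
    (F : ℝ → E → G) (hF : ∀ t ≤ (0 : ℝ), ∀ x, F t x = 0) :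
    ∫ t, ∫ x, F t x = ∫ s, ∫ y, (simDensity E (s, y) : ℝ) • F (simTime s) (Real.exp s • y) := by
  have h0 : ∫ t in Ioi 0, ∫ x, F t x = ∫ t, ∫ x, F t x := by
    refine setIntegral_eq_integral_of_forall_compl_eq_zero fun t ht => ?_
    simp only [mem_Ioi, not_lt] at ht
    simp only [hF t ht, integral_zero]
  rw [← h0, integral_Ioi_eq_integral_simTime]
  refine integral_congr_ae (Eventually.of_forall fun s => ?_)
  have h1 : ∫ x, F (simTime s) x = (Real.exp s ^ finrank ℝ E) • ∫ y, F (simTime s) (Real.exp s • y) := by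
    rw [integral_comp_exp_smul s (F (simTime s)), smul_smul, mul_inv_cancel₀ (by positivity),
      one_smul]
  simp only
  rw [h1, smul_smul, ← integral_smul]
  refine integral_congr_ae (Eventually.of_forall fun y => ?_)
  simp only [coe_simDensity]
  congr 1
  rw [← Real.exp_nat_mul, ← Real.exp_add]
  congr 1
  ring

/-- **Iterated change of variables** (lower integral):
`∫⁻_{t>0} dt ∫⁻ dx F(t, x) = ∫⁻ ds ∫⁻ dy e^{(n+2)s} F(Φ(s, y))`. [folklore] -/
theorem lintegral_Ioi_lintegral_eq_simMap (F : ℝ → E → ℝ≥0∞) :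
    ∫⁻ t in Ioi 0, ∫⁻ x, F t x =
      ∫⁻ s, ∫⁻ y, (simDensity E (s, y) : ℝ≥0∞) * F (simTime s) (Real.exp s • y) := by
  rw [lintegral_Ioi_eq_lintegral_simTime]
  refine lintegral_congr fun s => ?_
  have h1 : ∫⁻ x, F (simTime s) x =
      ENNReal.ofReal (Real.exp s ^ finrank ℝ E) * ∫⁻ y, F (simTime s) (Real.exp s • y) := by
    rw [lintegral_comp_exp_smul s (F (simTime s)), ← mul_assoc, ← ENNReal.ofReal_mul (by positivity),
      mul_inv_cancel₀ (by positivity), ENNReal.ofReal_one, one_mul]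
  rw [h1, ← mul_assoc, ← lintegral_const_mul' _ _ (by finiteness)]
  refine lintegral_congr fun y => ?_
  rw [← ENNReal.ofReal_mul (Real.exp_pos _).le, ← ENNReal.ofReal_coe_nnreal, coe_simDensity]
  congr 2
  rw [← Real.exp_nat_mul, ← Real.exp_add]
  congr 1
  simp only
  ring

/-- **Local integrability on the slab of a transported field.** If `H` is locally integrable on
`ℝ × E` and `c` is continuous on the open slab `(0,∞) × E`, then `z ↦ c(z) • H(Φ⁻¹ z)` is locally
integrable on the slab (on a compact `K` in the slab it is, after the change of variables, the
integrable `H` on the compact `Φ⁻¹(K)` times a continuous factor). [folklore] -/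
theorem locallyIntegrableOn_slab_smul_comp_simInv {G : Type*} [NormedAddCommGroup G]
    [NormedSpace ℝ G] {H : ℝ × E → G} (hH : LocallyIntegrable H volume) {c : ℝ × E → ℝ}
    (hc : ContinuousOn c (Ioi (0 : ℝ) ×ˢ (univ : Set E))) :
    LocallyIntegrableOn (fun z => c z • H (simInv z)) (Ioi (0 : ℝ) ×ˢ (univ : Set E)) volume := by
  have hopen : IsOpen (Ioi (0 : ℝ) ×ˢ (univ : Set E)) := isOpen_Ioi.prod isOpen_univ
  rw [locallyIntegrableOn_iff hopen.isLocallyClosed]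
  intro K hK hKc
  have h1 : K ∩ Ioi (0 : ℝ) ×ˢ (univ : Set E) = K := inter_eq_left.2 hK
  rw [← h1, integrableOn_inter_slab_iff _ hKc.measurableSet]
  have hK' : IsCompact ((simMap : ℝ × E → ℝ × E) ⁻¹' K) := isCompact_preimage_simMap hKc hK
  have hHK : IntegrableOn H (simMap ⁻¹' K) volume := hH.integrableOn_isCompact hK'
  have hcont : ContinuousOn (fun z : ℝ × E => (simDensity E z : ℝ) * c (simMap z))
      (simMap ⁻¹' K) :=
    (continuous_subtype_val.comp continuous_simDensity).continuousOn.mul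
      (hc.comp continuous_simMap.continuousOn fun z _ => simMap_mem_slab z)
  refine (hHK.continuousOn_smul hcont hK').congr_fun (fun z _ => ?_) (measurable_simMap hKc.measurableSet)
  simp only [simInv_simMap, smul_smul]

end Measure

/-! ### Pull-back of space–time fields along `Φ` and the chain rules -/

section Pull

variable {E : Type*} [NormedAddCommGroup E] [InnerProductSpace ℝ E]
variable {F : Type*}

/-- **Pull-back along the similarity change of variables**: `simPull ψ (s, y) = ψ(e^{2s}/2, eˢ y)`,
the field `ψ(t, x)` read in the similarity variables of [BT1] (1.7). [cite: BradshawTsai2017AHP, (1.7)] -/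
def simPull (ψ : ℝ → E → F) : ℝ → E → F := fun s y => ψ (simTime s) (Real.exp s • y)

/-- Unfolding `simPull`. [folklore] -/
@[simp]
theorem simPull_apply (ψ : ℝ → E → F) (s : ℝ) (y : E) :
    simPull ψ s y = ψ (simTime s) (Real.exp s • y) := rfl

/-- `uncurry (ψ ∘ Φ) = uncurry ψ ∘ Φ`. [folklore] -/
theorem uncurry_simPull (ψ : ℝ → E → F) : uncurry (simPull ψ) = uncurry ψ ∘ simMap := by
  funext z; rfl

/-- At fixed `s` the slice of the pull-back is an affine pull-back with dilation `γ = eˢ`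
(`stPull` of `SpaceTimeRescaling` with `β = 0`, `t₀ = τ(s)`, `x₀ = 0`). [folklore] -/
theorem simPull_slice_eq_stPull (ψ : ℝ → E → F) (s : ℝ) :
    simPull ψ s = stPull 0 (Real.exp s) (simTime s) (0 : E) ψ 0 := by
  funext y
  simp only [simPull_apply, stPull_apply, mul_zero, add_zero, zero_add]

variable [NormedAddCommGroup F] [NormedSpace ℝ F]

/-- **Chain rule in space**: `D_y(ψ ∘ Φ)(s, ·)(y) = eˢ D_xψ(t, ·)(x)` at `(t,x) = Φ(s,y)` (no
differentiability needed). [folklore] -/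
theorem fderiv_simPull (ψ : ℝ → E → F) (s : ℝ) (y : E) :
    fderiv ℝ (simPull ψ s) y = Real.exp s • fderiv ℝ (ψ (simTime s)) (Real.exp s • y) := by
  rw [simPull_slice_eq_stPull, fderiv_stPull]
  simp only [mul_zero, add_zero, zero_add]

/-- Chain rule for the convective derivative along any vector field `a`:
`((a·∇)(ψ ∘ Φ))(s, y) = eˢ D_xψ(Φ(s,y))[a(y)]`. [folklore] -/
theorem convect_simPull {F' : Type*} [NormedAddCommGroup F'] [InnerProductSpace ℝ F']
    (a : E → E) (ψ : ℝ → E → F') (s : ℝ) (y : E) :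
    convect a (simPull ψ s) y = Real.exp s • fderiv ℝ (ψ (simTime s)) (Real.exp s • y) (a y) := by
  rw [convect_apply, fderiv_simPull]
  rfl

/-- Chain rule for the gradient of a pulled-back scalar field: `∇(θ ∘ Φ)(s,y) = eˢ ∇θ(Φ(s,y))`. [folklore] -/
theorem gradient_simPull [CompleteSpace E] (θ : ℝ → E → ℝ) (s : ℝ) (y : E) :
    gradient (simPull θ s) y = Real.exp s • gradient (θ (simTime s)) (Real.exp s • y) := by
  rw [simPull_slice_eq_stPull, gradient_stPull]
  simp only [mul_zero, add_zero, zero_add]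

/-- Chain rule for the divergence of a pulled-back vector field:
`div(ψ ∘ Φ)(s,y) = eˢ div ψ(Φ(s,y))`. [folklore] -/
theorem divergence_simPull [FiniteDimensional ℝ E] (ψ : ℝ → E → E) (s : ℝ) (y : E) :
    VectorCalculus.divergence (simPull ψ s) y =
      Real.exp s * VectorCalculus.divergence (ψ (simTime s)) (Real.exp s • y) := by
  rw [simPull_slice_eq_stPull, divergence_stPull]
  simp only [mul_zero, add_zero, zero_add]

/-- Chain rule for the Laplacian of a pulled-back field with `C²` slice:
`Δ_y(ψ ∘ Φ)(s,·)(y) = e^{2s} Δ_xψ(t,·)(x)` at `(t,x) = Φ(s,y)`. [folklore] -/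
theorem laplacian_simPull [FiniteDimensional ℝ E] (ψ : ℝ → E → F) (s : ℝ) (y : E)
    (h : ContDiff ℝ 2 (ψ (simTime s))) :
    (Δ (simPull ψ s)) y = Real.exp (2 * s) • (Δ (ψ (simTime s))) (Real.exp s • y) := by
  rw [simPull_slice_eq_stPull, laplacian_stPull _ _ _ _ _ _ _ (by simpa using h)]
  simp only [mul_zero, add_zero, zero_add]
  rw [two_mul, Real.exp_add, ← sq]

/-- **Chain rule in time** (`HasDerivAt` form): if `uncurry ψ` is differentiable at `Φ(s, y)` with
derivative `L`, then `r ↦ (ψ ∘ Φ)(r, y)` has derivative `e^{2s} L(1,0) + L(0, eˢ y)` at `s`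
(the curve `r ↦ Φ(r, y)` has velocity `(e^{2r}, eʳ y)`). [folklore] -/
theorem hasDerivAt_simPull {ψ : ℝ → E → F} {s : ℝ} {y : E} {L : ℝ × E →L[ℝ] F}
    (h : HasFDerivAt (uncurry ψ) L (simMap (s, y))) :
    HasDerivAt (fun r => simPull ψ r y) (Real.exp (2 * s) • L (1, 0) + L (0, Real.exp s • y)) s := by
  have hγ : HasDerivAt (fun r : ℝ => simMap (r, y)) (Real.exp (2 * s), Real.exp s • y) s := by
    have h1 := hasDerivAt_simTime s
    have h2 : HasDerivAt (fun r : ℝ => Real.exp r • y) (Real.exp s • y) s := by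
      simpa using (Real.hasDerivAt_exp s).smul_const y
    exact h1.prodMk h2
  have hc := h.comp_hasDerivAt s hγ
  have h3 : (uncurry ψ ∘ fun r : ℝ => simMap (r, y)) = fun r => simPull ψ r y := by
    funext r; rfl
  rw [h3] at hc
  convert hc using 1
  have h4 : ((Real.exp (2 * s), Real.exp s • y) : ℝ × E) =
      Real.exp (2 * s) • ((1 : ℝ), (0 : E)) + ((0 : ℝ), Real.exp s • y) := by
    simp
  rw [h4, map_add, map_smul]

/-- **Chain rule in time** (`timeDeriv` form): for `uncurry ψ` differentiable at `Φ(s,y)`,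
`∂ₛ(ψ ∘ Φ)(s, y) = e^{2s} ∂ₜψ(t, x) + D_xψ(t, x)[x]`, `(t, x) = Φ(s, y) = (e^{2s}/2, eˢ y)`; i.e.
`∂ₜψ = (2t)⁻¹ (∂ₛ − y·∇_y)(ψ ∘ Φ)` ([BT1] §4 and Remark 4.1). [cite: BradshawTsai2017AHP, §4 (proof of Thm 1.2)] -/
theorem timeDeriv_simPull {ψ : ℝ → E → F} {s : ℝ} {y : E}
    (h : DifferentiableAt ℝ (uncurry ψ) (simMap (s, y))) :
    timeDeriv (simPull ψ) s y =
      Real.exp (2 * s) • timeDeriv ψ (simTime s) (Real.exp s • y) +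
        fderiv ℝ (ψ (simTime s)) (Real.exp s • y) (Real.exp s • y) := by
  set L := fderiv ℝ (uncurry ψ) (simMap (s, y)) with hL
  have hψ : HasFDerivAt (uncurry ψ) L (simTime s, Real.exp s • y) := h.hasFDerivAt
  rw [timeDeriv_apply, (hasDerivAt_simPull hψ).deriv, timeDeriv_apply,
    (hasDerivAt_timeLine hψ).deriv, (hasFDerivAt_slice hψ).fderiv]
  rfl

/-! ### Test fields -/

/-- **Multiplication by a smooth time weight**: if `φ` is a space–time test field on `Q` and
`w : ℝ → ℝ` is smooth, then `(s, y) ↦ w(s) φ(s, y)` is a space–time test field on `Q`. [folklore] -/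
theorem IsSpaceTimeTestOn.time_smul {X : Type*} [NormedAddCommGroup X] [NormedSpace ℝ X]
    {Q : Opens (ℝ × X)} {φ : ℝ → X → F} (hφ : IsSpaceTimeTestOn Q φ) {w : ℝ → ℝ}
    (hw : ContDiff ℝ (⊤ : ℕ∞) w) : IsSpaceTimeTestOn Q (fun s y => w s • φ s y) := by
  have e : uncurry (fun s y => w s • φ s y) = fun z : ℝ × X => w z.1 • uncurry φ z := rfl
  refine ⟨?_, ?_, ?_⟩
  · rw [e]; exact (hw.comp contDiff_fst).smul hφ.contDiff
  · rw [e]; exact hφ.hasCompactSupport.smul_left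
  · rw [e]; exact (tsupport_smul_subset_right (fun z : ℝ × X => w z.1) (uncurry φ)).trans
      hφ.tsupport_subset

/-- Slices of a space–time test field on `ℝ × X` are test functions on `X` (same statement as the
tree's `IsSpaceTimeTestOn.isTestFunctionOn_slice` of `KatoUniquenessDual`, restated to keep the
import graph light). [folklore] -/
theorem IsSpaceTimeTestOn.slice_isTestFunctionOn_top {X : Type*} [NormedAddCommGroup X]
    [NormedSpace ℝ X] {φ : ℝ → X → F} (hφ : IsSpaceTimeTestOn (⊤ : Opens (ℝ × X)) φ) (t : ℝ) :
    FunctionSpaces.IsTestFunctionOn (⊤ : Opens X) (φ t) where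
  contDiff := hφ.contDiff_slice t
  hasCompactSupport := hφ.hasCompactSupport_slice t
  tsupport_subset _ _ := trivial

/-- **Pull-back of test fields on the slab**: if `ψ ∈ C_c^∞((0,∞) × E)` then
`ψ ∘ Φ ∈ C_c^∞(ℝ × E)` (smooth by the chain rule; the support of `ψ ∘ Φ` is `Φ⁻¹` of the support
of `ψ`, a compact subset of the open slab, on which `Φ⁻¹` is continuous). [folklore] -/
theorem IsSpaceTimeTestOn.simPull {ψ : ℝ → E → F}
    (hψ : IsSpaceTimeTestOn (slab E (Ioi 0) isOpen_Ioi) ψ) :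
    IsSpaceTimeTestOn (⊤ : Opens (ℝ × E)) (FluidPDE.simPull ψ) := by
  change FunctionSpaces.IsTestFunctionOn _ (uncurry (FluidPDE.simPull ψ))
  rw [uncurry_simPull]
  refine ⟨hψ.contDiff.comp contDiff_simMap, ?_, fun _ _ => trivial⟩
  have hsub : tsupport (uncurry ψ ∘ simMap) ⊆ simMap ⁻¹' tsupport (uncurry ψ) := by
    rw [tsupport, Function.support_comp_eq_preimage]
    exact continuous_simMap.closure_preimage_subset _
  have hK : IsCompact ((simMap : ℝ × E → ℝ × E) ⁻¹' tsupport (uncurry ψ)) :=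
    isCompact_preimage_simMap hψ.hasCompactSupport (by
      simpa only [coe_slab] using hψ.tsupport_subset)
  exact hK.of_isClosed_subset (isClosed_tsupport _) hsub

/-- The pulled-back test field with a smooth time weight, `(s,y) ↦ w(s) ψ(Φ(s,y))`, is a test field
on `ℝ × E` (the test fields `ζ = f/(2t)`, `φ = ψ/√(2t)` of [BT1] §4 read backwards:
`f = e^{2s} ζ ∘ Φ`, `ψ = eˢ φ ∘ Φ`). [cite: BradshawTsai2017AHP, §4 (proof of Thm 1.2)] -/
theorem IsSpaceTimeTestOn.time_smul_simPull {ψ : ℝ → E → F}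
    (hψ : IsSpaceTimeTestOn (slab E (Ioi 0) isOpen_Ioi) ψ) {w : ℝ → ℝ} (hw : ContDiff ℝ (⊤ : ℕ∞) w) :
    IsSpaceTimeTestOn (⊤ : Opens (ℝ × E)) (fun s y => w s • FluidPDE.simPull ψ s y) :=
  hψ.simPull.time_smul hw

/-- A test field on the slab vanishes at `Φ⁻¹`-preimages… concretely: its pull-back, its time
derivative and its slice derivatives all live on `ℝ × E`, and the original field vanishes for
`t ≤ 0` together with its slice derivative and time derivative. [folklore] -/
theorem IsSpaceTimeTestOn.eq_zero_of_nonpos {ψ : ℝ → E → F}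
    (hψ : IsSpaceTimeTestOn (slab E (Ioi 0) isOpen_Ioi) ψ) {t : ℝ} (ht : t ≤ 0) (x : E) :
    ψ t x = 0 :=
  hψ.apply_eq_zero (by simpa using ht)

/-- The slice of a test field on the slab at a time `t ≤ 0` is identically zero. [folklore] -/
theorem IsSpaceTimeTestOn.slice_eq_zero_of_nonpos {ψ : ℝ → E → F}
    (hψ : IsSpaceTimeTestOn (slab E (Ioi 0) isOpen_Ioi) ψ) {t : ℝ} (ht : t ≤ 0) : ψ t = 0 :=
  funext fun x => hψ.eq_zero_of_nonpos ht x

/-- The time derivative of a test field on the slab vanishes at times `t ≤ 0` (the time line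
through `(t, x)` vanishes on the open set `t < … ` — indeed on a neighbourhood of `t`, since the
support is a compact subset of the open slab). [folklore] -/
theorem IsSpaceTimeTestOn.timeDeriv_eq_zero_of_nonpos {ψ : ℝ → E → F}
    (hψ : IsSpaceTimeTestOn (slab E (Ioi 0) isOpen_Ioi) ψ) {t : ℝ} (ht : t ≤ 0) (x : E) :
    timeDeriv ψ t x = 0 := by
  -- the support in time is bounded away from `0`
  obtain ⟨K, hK, hKt⟩ : ∃ a : ℝ, 0 < a ∧ ∀ t' x', t' ≤ a → ψ t' x' = 0 := by
    by_cases hne : (tsupport (uncurry ψ)).Nonempty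
    · obtain ⟨z₀, hz₀, hmin⟩ := hψ.hasCompactSupport.exists_isMinOn hne continuous_fst.continuousOn
      have hz₀pos : 0 < z₀.1 := by simpa using hψ.tsupport_subset hz₀
      refine ⟨z₀.1 / 2, by positivity, fun t' x' ht' => ?_⟩
      by_contra hne'
      have hmem : (t', x') ∈ tsupport (uncurry ψ) := subset_tsupport _ (by simpa using hne')
      have := hmin hmem
      simp only [mem_setOf_eq] at this
      linarith
    · refine ⟨1, one_pos, fun t' x' _ => ?_⟩
      have : (t', x') ∉ tsupport (uncurry ψ) := fun h => hne ⟨_, h⟩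
      exact (image_eq_zero_of_notMem_tsupport this : uncurry ψ (t', x') = 0)
  rw [timeDeriv_apply]
  have hev : (fun s => ψ s x) =ᶠ[𝓝 t] fun _ => 0 :=
    (eventually_le_nhds (show t < K by linarith)).mono fun s hs => hKt s x hs
  rw [hev.deriv_eq, deriv_const]

end Pull

end Literature.Analysis.FluidPDE

end
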